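import Literature.Geometry.Lorentzian.CoordLaplacianPerturbation
import HarnessLib

/-!
# The Ricci tensor of the conformal model of the round cylinder: `Ric(a|x|⁻² δ) = (n−2)|x|⁻² (δ − x̂ ⊗ x̂)`

Pure Fréchet calculus in the `MetricCoord` framework (`CoordCurvature.lean`,
`ConformalCoordCurvature.lean`, `CoordLaplacianPerturbation.lean`; everything PROVED, no definitions,
no named facts). On a finite-dimensional real inner product space `E` of dimension `n`, the
conformally flat components `y ↦ (a ‖y‖⁻²) · δ` on `E ∖ {0}` (`a ≠ 0` a constant, `δ = ⟪·,·⟫`)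
are the **standard round cylinder in logarithmic polar coordinates**: `x = e^{s/√a} θ` carries
`ds² + a g_{Sⁿ⁻¹}` to `a |x|⁻² |dx|²` (for `a = (n−1)(n−2)` the sphere factor has scalar
curvature `1`, Chen–Zhu's normalisation; this is the model metric `cylTensor` of the tree's
`Cᵏ`-necks, `Literature.Geometry.Riemannian.CkNecks`, R. Hamilton, Comm. Anal. Geom. 5 (1997),
§C2, p. 31). We compute its Ricci tensor from Besse's formula for conformal changes
(`IsMetricOn.ricAt_conformal`, Besse 1987, Thm. 1.159 (d)), the flat components having vanishing
Christoffel map (`chrAt_const`) hence vanishing curvature (`riemAt_const`, `ricAt_const`):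

* `confForm_cyl` — `θ = d c/(2c) = −⟪y, ·⟫/‖y‖²`; `confVec_cyl` — `θ♯ = −y/‖y‖²`;
  `fderiv_confForm_cyl` — `Dθ(v)(w) = −⟪v,w⟫/‖y‖² + 2⟪y,v⟫⟪y,w⟫/‖y‖⁴`; `confHess_cyl`,
  `mtrAt_confHess_cyl` (`tr_δ H = (2 − n)/‖y‖²`), `confForm_confVec_cyl` (`|θ|² = 1/‖y‖²`);
* `ricAt_cyl` — **`Ric_{a|·|⁻²δ}(y)(v, w) = (n − 2) ‖y‖⁻² (⟪v, w⟫ − ⟪y, v⟫⟪y, w⟫/‖y‖²)`**;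
  in particular the radial direction is in the kernel (`ricAt_cyl_radial`: `Ric(y, w) = 0`) and
  `Ric(v, v) = (n−2) ‖y‖⁻² (‖v‖² − ⟪y,v⟫²/‖y‖²) ≥ 0` (`ricAt_cyl_self`) — the axial direction of a
  neck is the kernel of its (scale-invariant) Ricci tensor, which is how the axes of two
  overlapping `ε`-necks are compared (Hamilton 1997, §C2).

## References

* A. L. Besse, *Einstein manifolds*, Springer 1987, Thm. 1.159 (d). [Besse1987]
* B. O'Neill, *Semi-Riemannian geometry*, Academic Press 1983, Ch. 3, Lemma 3.52, and Ch. 7,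
  Cor. 7.43 (curvature of warped products). [ONeill1983]
* R. S. Hamilton, *Four-manifolds with positive isotropic curvature*, Comm. Anal. Geom. 5 (1997),
  §C2, p. 31. [Hamilton1997]
-/

noncomputable section

set_option maxSynthPendingDepth 3

open Set Filter ContinuousLinearMap Module
open scoped Topology ContDiff RealInnerProductSpace

namespace Literature.Geometry.Lorentzian

namespace MetricCoord

/-! ### Flat components have no curvature -/

section FlatCurvature

variable {E : Type*} [NormedAddCommGroup E] [InnerProductSpace ℝ E]

/-- **Constant components are flat**: `R_B = 0` (`Γ_B = 0` identically, `chrAt_const`).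
[cite: ONeill1983, Ch. 3, Lemma 3.38] -/
theorem riemAt_const (B : E →L[ℝ] E →L[ℝ] ℝ) (x X Y Z : E) :
    riemAt (fun _ : E ↦ B) x X Y Z = 0 := by
  have hf : fderiv ℝ (chrAt (fun _ : E ↦ B)) x = 0 := by
    have h1 := hasFDerivAt_const (𝕜 := ℝ) (chrAt (fun _ : E ↦ B) x) x
    have h2 : chrAt (fun _ : E ↦ B) =ᶠ[𝓝 x] fun _ : E ↦ chrAt (fun _ : E ↦ B) x :=
      Filter.Eventually.of_forall fun y ↦ by rw [chrAt_const, chrAt_const]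
    exact (h1.congr_of_eventuallyEq h2).fderiv
  rw [riemAt_apply, hf, chrAt_const]
  simp

/-- The Ricci form of constant components vanishes. [cite: ONeill1983, Ch. 3, Lemma 3.52] -/
theorem ricAt_const [FiniteDimensional ℝ E] (B : E →L[ℝ] E →L[ℝ] ℝ) (x Y Z : E) :
    ricAt (fun _ : E ↦ B) x Y Z = 0 := by
  rw [ricAt_eq_sum_coord (Module.finBasis ℝ E)]
  simp [riemAt_const]

end FlatCurvature

/-! ### The conformal factor `a ‖y‖⁻²` and its conformal data -/

section Cylinder

variable {E : Type*} [NormedAddCommGroup E] [InnerProductSpace ℝ E]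

/-- **The derivative of `y ↦ (‖y‖²)⁻¹`** at `y ≠ 0`: `v ↦ −2⟪y, v⟫/‖y‖⁴`. [folklore] -/
theorem hasFDerivAt_inv_norm_sq {y : E} (hy : y ≠ 0) :
    HasFDerivAt (fun z : E ↦ (‖z‖ ^ 2)⁻¹)
      ((-((‖y‖ ^ 2) ^ 2)⁻¹ * 2) • (innerSL ℝ y : E →L[ℝ] ℝ)) y := by
  have hne : ‖y‖ ^ 2 ≠ 0 := pow_ne_zero 2 (norm_ne_zero_iff.2 hy)
  have h := (hasFDerivAt_inv hne).comp y (hasStrictFDerivAt_norm_sq y).hasFDerivAt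
  refine h.congr_fderiv ?_
  ext v
  simp only [ContinuousLinearMap.comp_apply, ContinuousLinearMap.toSpanSingleton_apply,
    smul_apply, innerSL_apply_apply, smul_eq_mul]
  ring

/-- `y ↦ (‖y‖²)⁻¹` is smooth off the origin. [folklore] -/
theorem contDiffOn_inv_norm_sq : ContDiffOn ℝ ∞ (fun z : E ↦ (‖z‖ ^ 2)⁻¹) {0}ᶜ := fun _ hy ↦
  ((contDiffAt_id.norm_sq ℝ).inv (pow_ne_zero 2 (norm_ne_zero_iff.2 hy))).contDiffWithinAt

variable {a : ℝ}

/-- The conformal factor `c(y) = a/‖y‖²` is smooth off the origin. [folklore] -/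
theorem contDiffOn_cylFactor : ContDiffOn ℝ ∞ (fun z : E ↦ a * (‖z‖ ^ 2)⁻¹) {0}ᶜ :=
  contDiffOn_const.mul contDiffOn_inv_norm_sq

omit [InnerProductSpace ℝ E] in
/-- `c(y) = a/‖y‖² ≠ 0` off the origin for `a ≠ 0`. [folklore] -/
theorem cylFactor_ne_zero (ha : a ≠ 0) {y : E} (hy : y ≠ 0) : a * (‖y‖ ^ 2)⁻¹ ≠ 0 :=
  mul_ne_zero ha (inv_ne_zero (pow_ne_zero 2 (norm_ne_zero_iff.2 hy)))

/-- The derivative of the conformal factor: `dc(y)(v) = −2a⟪y, v⟫/‖y‖⁴`. [folklore] -/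
theorem fderiv_cylFactor_apply {y : E} (hy : y ≠ 0) (v : E) :
    fderiv ℝ (fun z : E ↦ a * (‖z‖ ^ 2)⁻¹) y v = a * (-((‖y‖ ^ 2) ^ 2)⁻¹ * 2 * ⟪y, v⟫) := by
  rw [((hasFDerivAt_inv_norm_sq hy).const_mul a).fderiv]
  simp only [smul_apply, innerSL_apply_apply, smul_eq_mul]

/-- **The conformal one-form of the cylinder model**: `θ_y(v) = dc(y)(v)/(2 c(y)) = −⟪y, v⟫/‖y‖²`.
[cite: Besse1987, Thm. 1.159] -/
theorem confForm_cyl (ha : a ≠ 0) {y : E} (hy : y ≠ 0) (v : E) :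
    confForm (fun z : E ↦ a * (‖z‖ ^ 2)⁻¹) y v = -((‖y‖ ^ 2)⁻¹ * ⟪y, v⟫) := by
  have hne : ‖y‖ ^ 2 ≠ 0 := pow_ne_zero 2 (norm_ne_zero_iff.2 hy)
  rw [confForm_apply, fderiv_cylFactor_apply hy]
  have hy2 : (‖y‖ ^ 2) ^ 2 ≠ 0 := pow_ne_zero 2 hne
  field_simp

/-- The conformal one-form of the cylinder model as a field of continuous linear maps off the
origin: `θ_y = −‖y‖⁻² ⟪y, ·⟫`. [folklore] -/
theorem confForm_cyl_eq (ha : a ≠ 0) {y : E} (hy : y ≠ 0) :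
    confForm (fun z : E ↦ a * (‖z‖ ^ 2)⁻¹) y = (-(‖y‖ ^ 2)⁻¹) • (innerSL ℝ y : E →L[ℝ] ℝ) := by
  ext v
  rw [confForm_cyl ha hy, smul_apply, innerSL_apply_apply, smul_eq_mul, neg_mul]

/-- **The derivative of the conformal one-form**:
`Dθ(y)(v)(w) = −⟪v, w⟫/‖y‖² + 2⟪y, v⟫⟪y, w⟫/‖y‖⁴`. [folklore] -/
theorem fderiv_confForm_cyl (ha : a ≠ 0) {y : E} (hy : y ≠ 0) (v w : E) :
    fderiv ℝ (confForm (fun z : E ↦ a * (‖z‖ ^ 2)⁻¹)) y v w =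
      -((‖y‖ ^ 2)⁻¹ * ⟪v, w⟫) + 2 * ((‖y‖ ^ 2) ^ 2)⁻¹ * (⟪y, v⟫ * ⟪y, w⟫) := by
  -- `θ` agrees near `y` with `Θ z = -(‖z‖²)⁻¹ • ⟪z, ·⟫`
  set Θ : E → E →L[ℝ] ℝ := fun z ↦ (-(‖z‖ ^ 2)⁻¹) • (innerSL ℝ z : E →L[ℝ] ℝ) with hΘ
  have hev : confForm (fun z : E ↦ a * (‖z‖ ^ 2)⁻¹) =ᶠ[𝓝 y] Θ := by
    filter_upwards [isOpen_compl_singleton.mem_nhds hy] with z hz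
    exact confForm_cyl_eq ha hz
  rw [hev.fderiv_eq]
  -- product rule for `Θ = f • L`, `f z = -(‖z‖²)⁻¹`, `L = innerSL ℝ`
  have hf : HasFDerivAt (fun z : E ↦ -(‖z‖ ^ 2)⁻¹)
      (-((-((‖y‖ ^ 2) ^ 2)⁻¹ * 2) • (innerSL ℝ y : E →L[ℝ] ℝ))) y :=
    (hasFDerivAt_inv_norm_sq hy).neg
  have hL : HasFDerivAt (fun z : E ↦ (innerSL ℝ z : E →L[ℝ] ℝ)) (innerSL ℝ : E →L[ℝ] E →L[ℝ] ℝ) y :=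
    (innerSL ℝ : E →L[ℝ] E →L[ℝ] ℝ).hasFDerivAt
  have hΘd : HasFDerivAt Θ ((-(‖y‖ ^ 2)⁻¹) • (innerSL ℝ : E →L[ℝ] E →L[ℝ] ℝ) +
      (-((-((‖y‖ ^ 2) ^ 2)⁻¹ * 2) • (innerSL ℝ y : E →L[ℝ] ℝ))).smulRight
        (innerSL ℝ y : E →L[ℝ] ℝ)) y := hf.smul hL
  rw [hΘd.fderiv]
  have hinner : ∀ v w : E, (innerSL ℝ : E →L[ℝ] E →L[ℝ] ℝ) v w = ⟪v, w⟫ := fun v w ↦ rfl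
  simp only [add_apply, smul_apply, ContinuousLinearMap.smulRight_apply, neg_apply, hinner,
    smul_eq_mul]
  ring

/-- **The covariant Hessian of the conformal exponent** (with respect to the flat `δ`, whose
Christoffel map vanishes): `H(v, w) = Dθ(v)(w)`. [cite: ONeill1983, Ch. 3, Lemma 3.49] -/
theorem confHess_cyl {δ : E →L[ℝ] E →L[ℝ] ℝ} (ha : a ≠ 0) {y : E} (hy : y ≠ 0) (v w : E) :
    confHess (fun _ : E ↦ δ) (fun z : E ↦ a * (‖z‖ ^ 2)⁻¹) y v w =
      -((‖y‖ ^ 2)⁻¹ * ⟪v, w⟫) + 2 * ((‖y‖ ^ 2) ^ 2)⁻¹ * (⟪y, v⟫ * ⟪y, w⟫) := by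
  rw [confHess_apply, chrAt_const, fderiv_confForm_cyl ha hy]
  simp

variable [FiniteDimensional ℝ E] {δ : E →L[ℝ] E →L[ℝ] ℝ} (hδ : ∀ v w : E, δ v w = ⟪v, w⟫)
include hδ

/-- **The conformal vector field of the cylinder model**: `θ♯ = −y/‖y‖²` (index raising with
`δ` is the Riesz map, `inner_sharpAt_const_inner`). [folklore] -/
theorem confVec_cyl (ha : a ≠ 0) {y : E} (hy : y ≠ 0) :
    confVec (fun _ : E ↦ δ) (fun z : E ↦ a * (‖z‖ ^ 2)⁻¹) y = (-(‖y‖ ^ 2)⁻¹) • y := by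
  apply ext_inner_right ℝ
  intro w
  rw [confVec, inner_sharpAt_const_inner hδ, confForm_cyl ha hy, real_inner_smul_left]
  ring

/-- `θ(θ♯) = |θ|² = 1/‖y‖²`. [folklore] -/
theorem confForm_confVec_cyl (ha : a ≠ 0) {y : E} (hy : y ≠ 0) :
    confForm (fun z : E ↦ a * (‖z‖ ^ 2)⁻¹) y
      (confVec (fun _ : E ↦ δ) (fun z : E ↦ a * (‖z‖ ^ 2)⁻¹) y) = (‖y‖ ^ 2)⁻¹ := by
  have hne : ‖y‖ ^ 2 ≠ 0 := pow_ne_zero 2 (norm_ne_zero_iff.2 hy)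
  rw [confVec_cyl hδ ha hy, confForm_cyl ha hy, real_inner_smul_right, real_inner_self_eq_norm_sq]
  field_simp

/-- **The trace of the Hessian**: `tr_δ H = (2 − n)/‖y‖²` (`∑ᵢ ⟪y, bᵢ⟫² = ‖y‖²` in an
orthonormal basis). [folklore] -/
theorem mtrAt_confHess_cyl (ha : a ≠ 0) {y : E} (hy : y ≠ 0) :
    mtrAt (fun _ : E ↦ δ) y (confHess (fun _ : E ↦ δ) (fun z : E ↦ a * (‖z‖ ^ 2)⁻¹) y) =
      (2 - Module.finrank ℝ E : ℝ) * (‖y‖ ^ 2)⁻¹ := by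
  have hne : ‖y‖ ^ 2 ≠ 0 := pow_ne_zero 2 (norm_ne_zero_iff.2 hy)
  set b := stdOrthonormalBasis ℝ E with hb
  rw [mtrAt_const_inner_eq_sum hδ b]
  simp only [confHess_cyl ha hy]
  have h1 : ∀ i, ⟪b i, b i⟫ = (1 : ℝ) := fun i ↦ by
    rw [real_inner_self_eq_norm_sq, b.orthonormal.1 i, one_pow]
  have h2 : ∑ i, ⟪y, b i⟫ * ⟪y, b i⟫ = ‖y‖ ^ 2 := by
    have := b.sum_inner_mul_inner y y
    simp_rw [real_inner_comm (b _) y] at this ⊢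
    rw [this, real_inner_self_eq_norm_sq]
  simp only [h1, mul_one]
  rw [Finset.sum_add_distrib, Finset.sum_const, Finset.card_univ, ← Finset.mul_sum, h2,
    nsmul_eq_mul, ← finrank_eq_card_basis b.toBasis]
  field_simp
  ring

variable [CompleteSpace E]

/-- **The Ricci tensor of the conformal model of the round cylinder**:
`Ric_{a|·|⁻²δ}(y)(v, w) = (n − 2) ‖y‖⁻² (⟪v, w⟫ − ⟪y, v⟫⟪y, w⟫/‖y‖²)` on `E ∖ {0}` (`a ≠ 0`),
by Besse's conformal-change formula from the flat components (`IsMetricOn.ricAt_conformal` with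
`Ric_δ = 0`, `Γ_δ = 0`). In logarithmic polar coordinates this is the Ricci tensor of the product
`ds² + a g_{Sⁿ⁻¹}`: zero in the axial (radial) direction, `(n−2)/a` times the metric on the
sphere factor (O'Neill 1983, Cor. 7.43). [cite: Besse1987, Thm. 1.159 (d)] [cite: ONeill1983, Ch. 7, Cor. 7.43] -/
theorem ricAt_cyl (ha : a ≠ 0) {y : E} (hy : y ≠ 0) (v w : E) :
    ricAt (fun z : E ↦ (a * (‖z‖ ^ 2)⁻¹) • δ) y v w =
      (Module.finrank ℝ E - 2 : ℝ) * (‖y‖ ^ 2)⁻¹ *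
        (⟪v, w⟫ - (‖y‖ ^ 2)⁻¹ * (⟪y, v⟫ * ⟪y, w⟫)) := by
  have hne : ‖y‖ ^ 2 ≠ 0 := pow_ne_zero 2 (norm_ne_zero_iff.2 hy)
  have hG : IsMetricOn (fun _ : E ↦ δ) ({0}ᶜ : Set E) := isMetricOn_const_inner hδ isOpen_compl_singleton
  rw [hG.ricAt_conformal contDiffOn_cylFactor (fun z hz ↦ cylFactor_ne_zero ha hz) hy,
    ricAt_const, confHess_cyl ha hy, confForm_cyl ha hy, confForm_cyl ha hy,
    confForm_confVec_cyl hδ ha hy, mtrAt_confHess_cyl hδ ha hy, hδ]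
  field_simp
  ring

/-- **The radial direction is in the kernel of the cylinder's Ricci tensor**: `Ric(y, w) = 0`
(it is the axial direction `∂ₛ` of `ds² + a g_{Sⁿ⁻¹}`). [cite: ONeill1983, Ch. 7, Cor. 7.43] -/
theorem ricAt_cyl_radial (ha : a ≠ 0) {y : E} (hy : y ≠ 0) (w : E) :
    ricAt (fun z : E ↦ (a * (‖z‖ ^ 2)⁻¹) • δ) y y w = 0 := by
  have hne : ‖y‖ ^ 2 ≠ 0 := pow_ne_zero 2 (norm_ne_zero_iff.2 hy)
  rw [ricAt_cyl hδ ha hy, real_inner_self_eq_norm_sq]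
  field_simp
  ring

/-- **The cylinder's Ricci tensor as a quadratic form**:
`Ric(v, v) = (n − 2) ‖y‖⁻² (‖v‖² − ⟪y, v⟫²/‖y‖²)`, which is `(n−2) ‖y‖⁻²` times the squared
(Euclidean) norm of the component of `v` orthogonal to the radial direction; nonnegative for
`n ≥ 2` (Cauchy–Schwarz). [cite: ONeill1983, Ch. 7, Cor. 7.43] -/
theorem ricAt_cyl_self (ha : a ≠ 0) {y : E} (hy : y ≠ 0) (v : E) :
    ricAt (fun z : E ↦ (a * (‖z‖ ^ 2)⁻¹) • δ) y v v =
      (Module.finrank ℝ E - 2 : ℝ) * (‖y‖ ^ 2)⁻¹ * (‖v‖ ^ 2 - (‖y‖ ^ 2)⁻¹ * ⟪y, v⟫ ^ 2) := by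
  rw [ricAt_cyl hδ ha hy, real_inner_self_eq_norm_sq, sq ⟪y, v⟫]

omit [CompleteSpace E] [FiniteDimensional ℝ E] hδ in
/-- The transversal part of a vector is nonnegative: `⟪y, v⟫²/‖y‖² ≤ ‖v‖²` (Cauchy–Schwarz).
[folklore] -/
theorem inner_sq_div_le_norm_sq {y : E} (hy : y ≠ 0) (v : E) :
    (‖y‖ ^ 2)⁻¹ * ⟪y, v⟫ ^ 2 ≤ ‖v‖ ^ 2 := by
  have hpos : 0 < ‖y‖ ^ 2 := pow_pos (norm_pos_iff.2 hy) 2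
  rw [inv_mul_le_iff₀ hpos]
  have h := abs_real_inner_le_norm y v
  have h' : ⟪y, v⟫ ^ 2 ≤ (‖y‖ * ‖v‖) ^ 2 := by
    rw [← sq_abs]
    exact pow_le_pow_left₀ (abs_nonneg _) h 2
  nlinarith [h']

/-- Hence `Ric(v, v) ≥ 0` for the cylinder model in dimension `n ≥ 2`. [cite: ONeill1983, Ch. 7, Cor. 7.43] -/
theorem ricAt_cyl_self_nonneg (ha : a ≠ 0) (hn : 2 ≤ Module.finrank ℝ E) {y : E} (hy : y ≠ 0)
    (v : E) : 0 ≤ ricAt (fun z : E ↦ (a * (‖z‖ ^ 2)⁻¹) • δ) y v v := by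
  rw [ricAt_cyl_self hδ ha hy]
  have h1 : (0 : ℝ) ≤ (Module.finrank ℝ E - 2 : ℝ) := by
    have : (2 : ℝ) ≤ Module.finrank ℝ E := by exact_mod_cast hn
    linarith
  have h2 : (0 : ℝ) ≤ (‖y‖ ^ 2)⁻¹ := by positivity
  exact mul_nonneg (mul_nonneg h1 h2) (sub_nonneg.2 (inner_sq_div_le_norm_sq hy v))

end Cylinder

end MetricCoord

end Literature.Geometry.Lorentzian

end
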